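import Summits.CriticalPhenomena.Ising3DConformalLimit.Theorems.CoerciveSharpnessDimensionPinnedStubLowerEnvelope
import Literature.Probability.LatticeModels.PointwiseScalingLimitEtaExists
import HarnessLib

/-!
# A-priori bounds on the block variance of the critical Ising₃ two-point function
(routes CoerciveSharpness / ClusterRigidity / HelsonAxis, crux `DimensionPinned`,
item stmt-CriticalPhenomena-4662, line `Sketch` (idea `octave-telescoping-block-dock`),
registered stub `stub_blockVarianceBounds`)

Write `G := criticalTwoPoint 3` (the plus-state two-point function of the nearest-neighbour Ising
model on `ℤ³` at `β_c`), `g n := G (n e₀)`, `Q_L := [0, L)³ ∩ ℤ³`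
(`Fintype.piFinset fun _ => Finset.Ico 0 L`, `#Q_L = L³`) and `V_L := Σ_{x, y ∈ Q_L} G (y - x)`
(the block variance).  For `L ≥ 1`:

* (floor) `c L⁴ ≤ V_L` for a constant `c > 0` independent of `L`: by the Simon–Lieb lower bound
  `G z ≥ c ‖z‖⁻²` (`z ≠ 0`, tree theorem `criticalTwoPoint_bounds_holds`, Duminil-Copin 2019,
  Thm. 4.8) every one of the `L⁶` terms is `≥ min(c,1) L⁻²`, since `1 ≤ ‖y - x‖_∞ ≤ L` off the
  diagonal and `G 0 = 1` on it;
* (ceiling) `V_L ≤ L⁶`: every term is `≤ 1`;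
* (Messager–Miracle-Solé) `L⁶ g(3L) ≤ V_L`: every term is `≥ g(3L)`, by the sphere sandwich
  `g(3 ‖z‖_∞) ≤ G z` (`criticalTwoPoint_axis_sandwich`) and antitonicity of `g`
  (`criticalTwoPoint_axis_antitone`), as `3 ‖y - x‖_∞ ≤ 3L`.

References: H. Duminil-Copin, *Lectures on the Ising and Potts models on the hypercubic lattice*
(2019), Thm. 4.8 and eq. (4.10) [DuminilCopin2019]; A. Messager, S. Miracle-Solé, J. Stat. Phys. 17
(1977) 245–262 [MessagerMiracleSoleJSP1977].  No definitions are introduced.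
-/

noncomputable section

namespace Summit.CriticalPhenomena.Ising3DConformalLimit.Theorems.CoerciveSharpnessDimensionPinned

open scoped BigOperators
open Finset Literature.Probability.LatticeModels

/-- The difference of two points of `Q_L` has sup norm at most `L`. [folklore] -/
theorem blockVariance_supNorm_sub_le {L : ℕ} {x y : Site 3}
    (hx : x ∈ Fintype.piFinset (fun _ : Fin 3 => Finset.Ico (0:ℤ) (L:ℤ)))
    (hy : y ∈ Fintype.piFinset (fun _ : Fin 3 => Finset.Ico (0:ℤ) (L:ℤ))) :
    Site.supNorm (y - x) ≤ L := by
  rw [Fintype.mem_piFinset] at hx hy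
  refine Site.supNorm_le_iff.2 fun i => ?_
  have hxi := hx i
  have hyi := hy i
  simp only [Finset.mem_Ico] at hxi hyi
  rw [Pi.sub_apply]
  omega

/-- **Messager–Miracle-Solé, termwise**: every term `G (y - x)` of the block variance, `x, y ∈ Q_L`,
dominates the axis value `g(3L)`. [cite: MessagerMiracleSoleJSP1977, main theorem] -/
theorem blockVariance_axis_le_term {L : ℕ} {x y : Site 3}
    (hx : x ∈ Fintype.piFinset (fun _ : Fin 3 => Finset.Ico (0:ℤ) (L:ℤ)))
    (hy : y ∈ Fintype.piFinset (fun _ : Fin 3 => Finset.Ico (0:ℤ) (L:ℤ))) :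
    criticalTwoPoint 3 (Pi.single 0 ((3 * L : ℕ) : ℤ)) ≤ criticalTwoPoint 3 (y - x) := by
  by_cases h : y - x = 0
  · rw [h, criticalTwoPoint_zero']
    exact criticalTwoPoint_le_one' _
  · -- `y - x ≠ 0`, so `1 ≤ ‖y - x‖_∞` (`Site.supNorm_eq_zero_iff`)
    have hn : 1 ≤ Site.supNorm (y - x) :=
      Nat.one_le_iff_ne_zero.2 fun h0 => h (Site.supNorm_eq_zero_iff.1 h0)
    have hle : 3 * Site.supNorm (y - x) ≤ 3 * L :=
      Nat.mul_le_mul_left 3 (blockVariance_supNorm_sub_le hx hy)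
    exact (criticalTwoPoint_axis_antitone hle).trans (criticalTwoPoint_axis_sandwich hn).1

/-- **Simon–Lieb floor, uniform on the block**: there is `c₀ > 0` with `c₀ / L² ≤ G (y - x)` for all
`L ≥ 1` and `x, y ∈ Q_L`. [cite: DuminilCopin2019, Thm. 4.8] -/
theorem blockVariance_exists_floor :
    ∃ c₀ : ℝ, 0 < c₀ ∧ ∀ L : ℕ, 1 ≤ L → ∀ x y : Site 3,
      x ∈ Fintype.piFinset (fun _ : Fin 3 => Finset.Ico (0:ℤ) (L:ℤ)) →
      y ∈ Fintype.piFinset (fun _ : Fin 3 => Finset.Ico (0:ℤ) (L:ℤ)) →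
        c₀ / (L : ℝ) ^ 2 ≤ criticalTwoPoint 3 (y - x) := by
  obtain ⟨c, C, hc, hb⟩ := criticalTwoPoint_bounds_holds (d := 3) le_rfl
  refine ⟨min c 1, lt_min hc one_pos, fun L hL x y hx hy => ?_⟩
  have hL' : (1:ℝ) ≤ L := by exact_mod_cast hL
  have hL2 : (1:ℝ) ≤ (L:ℝ) ^ 2 := one_le_pow₀ hL'
  by_cases h : y - x = 0
  · rw [h, criticalTwoPoint_zero']
    calc min c 1 / (L:ℝ) ^ 2 ≤ min c 1 := div_le_self (le_min hc.le zero_le_one) hL2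
      _ ≤ 1 := min_le_right _ _
  · have hn : 1 ≤ Site.supNorm (y - x) :=
      Nat.one_le_iff_ne_zero.2 fun h0 => h (Site.supNorm_eq_zero_iff.1 h0)
    have hnL : Site.supNorm (y - x) ≤ L := blockVariance_supNorm_sub_le hx hy
    have h1 := (hb (y - x) h).1
    rw [Site.norm_eq_supNorm, show (-(((3 : ℕ) : ℝ) - 1)) = (-(2 : ℝ)) by norm_num,
      Real.rpow_neg (Nat.cast_nonneg _), Real.rpow_two] at h1
    have hnpos : (0:ℝ) < Site.supNorm (y - x) := by exact_mod_cast hn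
    have hnL' : (Site.supNorm (y - x) : ℝ) ≤ L := by exact_mod_cast hnL
    calc min c 1 / (L:ℝ) ^ 2 ≤ c / (L:ℝ) ^ 2 :=
          div_le_div_of_nonneg_right (min_le_left _ _) (by positivity)
      _ ≤ c * ((Site.supNorm (y - x) : ℝ) ^ 2)⁻¹ := by
          rw [div_eq_mul_inv]
          refine mul_le_mul_of_nonneg_left ?_ hc.le
          exact inv_anti₀ (pow_pos hnpos 2) (pow_le_pow_left₀ hnpos.le hnL' 2)
      _ ≤ criticalTwoPoint 3 (y - x) := h1

/-- A double sum over `s × s` whose terms are all `≥ b` is at least `#s² · b`. [folklore] -/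
theorem blockVariance_card_sq_mul_le_sum_sum {s : Finset (Site 3)} {f : Site 3 → Site 3 → ℝ} {b : ℝ}
    (h : ∀ x ∈ s, ∀ y ∈ s, b ≤ f x y) :
    (s.card : ℝ) ^ 2 * b ≤ ∑ x ∈ s, ∑ y ∈ s, f x y := by
  have hinner : ∀ x ∈ s, s.card • b ≤ ∑ y ∈ s, f x y := fun x hx =>
    Finset.card_nsmul_le_sum s (fun y => f x y) b fun y hy => h x hx y hy
  have hout := Finset.card_nsmul_le_sum s (fun x => ∑ y ∈ s, f x y) (s.card • b) hinner
  rw [nsmul_eq_mul, nsmul_eq_mul] at hout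
  calc (s.card : ℝ) ^ 2 * b = (s.card : ℝ) * ((s.card : ℝ) * b) := by ring
    _ ≤ ∑ x ∈ s, ∑ y ∈ s, f x y := hout

/-- A double sum over `s × s` whose terms are all `≤ b` is at most `#s² · b`. [folklore] -/
theorem blockVariance_sum_sum_le_card_sq_mul {s : Finset (Site 3)} {f : Site 3 → Site 3 → ℝ} {b : ℝ}
    (h : ∀ x ∈ s, ∀ y ∈ s, f x y ≤ b) :
    ∑ x ∈ s, ∑ y ∈ s, f x y ≤ (s.card : ℝ) ^ 2 * b := by
  have hinner : ∀ x ∈ s, ∑ y ∈ s, f x y ≤ s.card • b := fun x hx =>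
    Finset.sum_le_card_nsmul s (fun y => f x y) b fun y hy => h x hx y hy
  have hout := Finset.sum_le_card_nsmul s (fun x => ∑ y ∈ s, f x y) (s.card • b) hinner
  rw [nsmul_eq_mul, nsmul_eq_mul] at hout
  calc ∑ x ∈ s, ∑ y ∈ s, f x y ≤ (s.card : ℝ) * ((s.card : ℝ) * b) := hout
    _ = (s.card : ℝ) ^ 2 * b := by ring

/-- **A-priori bounds on the block variance `V_L = Σ_{x,y ∈ Q_L} ⟨σ_x σ_y⟩_{β_c(3)}`, `L ≥ 1`:**
`c L⁴ ≤ V_L ≤ L⁶` (Simon–Lieb floor `⟨σ₀σ_z⟩ ≥ c‖z‖⁻²` and `⟨σ₀σ_z⟩ ≤ 1`) and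
`L⁶ ⟨σ₀σ_{3L e₀}⟩ ≤ V_L` (Messager–Miracle-Solé sphere sandwich and axis monotonicity).
[cite: DuminilCopin2019, Thm. 4.8] -/
theorem stub_blockVarianceBounds :
    ∃ c : ℝ, 0 < c ∧ ∀ L : ℕ, 1 ≤ L →
      c * (L : ℝ) ^ 4 ≤
          (∑ x ∈ Fintype.piFinset (fun _ : Fin 3 => Finset.Ico (0:ℤ) (L:ℤ)),
            ∑ y ∈ Fintype.piFinset (fun _ : Fin 3 => Finset.Ico (0:ℤ) (L:ℤ)), criticalTwoPoint 3 (y - x)) ∧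
        (∑ x ∈ Fintype.piFinset (fun _ : Fin 3 => Finset.Ico (0:ℤ) (L:ℤ)),
            ∑ y ∈ Fintype.piFinset (fun _ : Fin 3 => Finset.Ico (0:ℤ) (L:ℤ)), criticalTwoPoint 3 (y - x)) ≤
          (L : ℝ) ^ 6 ∧
        (L : ℝ) ^ 6 * criticalTwoPoint 3 (Pi.single 0 ((3 * L : ℕ) : ℤ)) ≤
          (∑ x ∈ Fintype.piFinset (fun _ : Fin 3 => Finset.Ico (0:ℤ) (L:ℤ)),
            ∑ y ∈ Fintype.piFinset (fun _ : Fin 3 => Finset.Ico (0:ℤ) (L:ℤ)), criticalTwoPoint 3 (y - x)) := by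
  obtain ⟨c₀, hc₀, hfloor⟩ := blockVariance_exists_floor
  refine ⟨c₀, hc₀, fun L hL => ⟨?_, ?_, ?_⟩⟩
  · -- (a) the Simon–Lieb floor
    have h := blockVariance_card_sq_mul_le_sum_sum
      (s := Fintype.piFinset (fun _ : Fin 3 => Finset.Ico (0:ℤ) (L:ℤ)))
      (f := fun x y => criticalTwoPoint 3 (y - x)) (b := c₀ / (L : ℝ) ^ 2)
      fun x hx y hy => hfloor L hL x y hx hy
    rw [card_cube] at h
    have hL' : (L:ℝ) ≠ 0 := by exact_mod_cast Nat.one_le_iff_ne_zero.1 hL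
    calc c₀ * (L : ℝ) ^ 4 = ((L ^ 3 : ℕ) : ℝ) ^ 2 * (c₀ / (L : ℝ) ^ 2) := by
          push_cast
          field_simp
      _ ≤ _ := h
  · -- (b) the ceiling `G ≤ 1`
    have h := blockVariance_sum_sum_le_card_sq_mul
      (s := Fintype.piFinset (fun _ : Fin 3 => Finset.Ico (0:ℤ) (L:ℤ)))
      (f := fun x y => criticalTwoPoint 3 (y - x)) (b := 1)
      fun x _ y _ => criticalTwoPoint_le_one' (y - x)
    rw [card_cube] at h
    calc _ ≤ ((L ^ 3 : ℕ) : ℝ) ^ 2 * 1 := h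
      _ = (L : ℝ) ^ 6 := by push_cast; ring
  · -- (c) Messager–Miracle-Solé
    have h := blockVariance_card_sq_mul_le_sum_sum
      (s := Fintype.piFinset (fun _ : Fin 3 => Finset.Ico (0:ℤ) (L:ℤ)))
      (f := fun x y => criticalTwoPoint 3 (y - x))
      (b := criticalTwoPoint 3 (Pi.single 0 ((3 * L : ℕ) : ℤ)))
      fun x hx y hy => blockVariance_axis_le_term hx hy
    rw [card_cube] at h
    calc (L : ℝ) ^ 6 * criticalTwoPoint 3 (Pi.single 0 ((3 * L : ℕ) : ℤ))
        = ((L ^ 3 : ℕ) : ℝ) ^ 2 * criticalTwoPoint 3 (Pi.single 0 ((3 * L : ℕ) : ℤ)) := by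
          push_cast; ring
      _ ≤ _ := h

end Summit.CriticalPhenomena.Ising3DConformalLimit.Theorems.CoerciveSharpnessDimensionPinned

end
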